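import Summits.QuantumFields.YangMills.Theorems.BalabanUVNodesN15KingModelFullPropagatorGradTranspose

/-!
# BalabanUVNodes ∕ N15 — THE KING-MODEL RUNG, CURVED EDITION (PART Q3b): THE TRANSPOSED GRADIENT OF THE FULL `A = 0` FLUCTUATION PROPAGATOR
# AS AN OPERATOR, TWO-SPACING FORM — `|Σ_{y′} η′^{d+1}[∂^{η′}_μG^{η′}_{K+n}(y′, x′) − ∂^η_μG^η_K(y, x)]f′(y′)| ≤ C·(L^{−γ∕2})^K·e^{−δ·dist}·‖f′‖_∞`,
# ALL sources, uniformly in the number of levels ([B9] (3.42) entry `|G∇*_Uλ|` at `U ≡ 1`, two-spacing form)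
# (Track A, DAG node N15 = NE2; FAN-OUT v1.1 §N15 s3 «KING-MODEL RUNG …»; PART Q = NE2⁰'s OPERATOR LAYER ((3.42) sup entries) for King's full
# propagator with genuine η-lattice test functions)

HONEST FRAMING.  Count-neutral kernel bookkeeping (cell `pub-ymgap`, seat `pub-ymgap-dag-n15-e` g7; `--supports stmt-QuantumFields-20292 --as helper`
= K3⁗ `SpineGivenEndpointR13Sep`, lineage K3 19676 → 19908 → 19912 → 20292).  TEMPLATE LITERATURE, `A = 0`: C. King's scalar U(1)-Higgs MODEL on
finite tori ([King1986] (2.13)–(2.17) p. 653, (2.20) p. 654, Theorem 3.3 (3.7) p. 658, Prop. 3.8 (3.71) p. 664 second line, p. 664 «x′ ∈ B^n(x)»,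
§4 p. 675 (4.42)–(4.43); B4 (1.10) p. 573, (2.39) p. 582), NOT Bałaban's covariant objects; the statement below is the (2.17)-summed SHAPE of
(3.7) + (3.71) line 2 read in the second leg, not a printed proposition; NE2⁺ is NOT PRINTED for `G_k(U)∇*_U` and not proved here; NOT a node
discharge; nothing continuum ∕ ℝ⁴ ∕ OS ∕ mass-gap ∕ Clay.  0 `sorry`, 0 `def`, standard axioms.

THE POINT.  PART Q3a gave the single-run, level-uniform sup bound of the transposed gradient `Σ_y η^{d+1}∂^η_μG^η_K(y, x)f(y)` (the kernel of
`A₀⁻¹∇*_μ` at `U ≡ 1`, `G^η_K` symmetric).  THIS FILE is its two-spacing rate, by PART Q2b's paired induction run on the transposed peel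
(Q3a `fullPropDTOp_peel_pair`):
★ **`fullPropDTOp_rate_decay_unif`** — for odd `L ≥ 3`, `a > 0`, `m₀² ≥ 0`, `0 ≤ γ < 1`: `∃ C δ > 0 ∀ K n ≥ 1 ∀ cube 2L^e ∀ 0 < m² ≤ m₀² ∀ μ
∀ f′ (|f′| ≤ F) ∀ D ∈ ℕ ∀ x′` with `f′(y′) = 0` whenever `|B(x) − B(y)|_M < D`:
`|Σ_{y′}(L^nL^K)^{−(d+1)}·[L^nL^K·(G′(y′ + e_μ, x′) − G′(y′, x′)) − L^K·(G(y + e_μ, x) − G(y, x))]·f′(y′)| ≤ C·(L^{−γ∕2})^K·e^{−δD}·F`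
(`x, y` under `x′, y′`).  Step = Q3a `fullPropDTOp_peel_pair` + Q2a `pairOp_decay_le` on the transposed gradient-slice pair (part M′
`ksDSlice_rate_unif` at swapped legs, `tdistT_symm`) + IH, gain `L^{−1}(C + C_rK) ≤ C·θ` (`Lθ = L^{1−γ∕2} > 1`); base `K = 1`: the fine run
(`1 + n` levels) by Q3a's LEVEL-UNIFORM single-run bound `fullPropDTOp_decay_unif`, the coarse run by the one-level kernel bound
`constrainedProp_deriv_decay_blocks_unif` transposed, read through the pairing.
WHAT THE CURVED CASE ADDS (one line): Bałaban's `G_k(U)∇*_U λ` uniformly over the live window `Reg335`; print gives analyticity in `U` and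
η-uniformity (Thm 3.4), never an η-difference.
HONEST SCOPE.  (i) `A = 0`, periodic b.c., odd `L ≥ 3`, `0 < m² ≤ m₀²`, cubes `2L^e`; (ii) the coarse source is the fine one read through King's
pairing with the fine measure; (iii) `K, n ≥ 1`, `0 ≤ γ < 1`; (iv) the identification with `A₀⁻¹∇*` (symmetry of `G^η_K`) is read out downstream;
(v) block-distance currency; not Bałaban's `G_k(U)∇*_U`; not a discharge.
Locators: [King1986] C. King, CMP **102** (1986) 649–677: (2.13)–(2.17) p. 653, (2.20) p. 654, Theorem 3.3 (3.7) p. 658, Prop. 3.8 (3.71) p. 664,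
(4.42)–(4.43) p. 675; [Ba 4] = [Balaban1983RegularityDecay] Theorem (1.10) p. 573, (2.39) p. 582; [B9] = [Balaban1985BackgroundPropagators]
Thm 3.1 (3.42) p. 397 + Thm 3.14 pp. 426–427 (typing template).
-/

noncomputable section

namespace Summit.QuantumFields.YangMills.BalabanUVNodes.N15KingModelRung.Curved

open Real Finset Matrix
open Literature.MathematicalPhysics.QuantumFieldTheory.Balaban1983to89 (Params)
open Literature.MathematicalPhysics.QuantumFieldTheory.Balaban1983to89.B4Sect5Proof (latticeConst latticeConst_nonneg)
open Literature.MathematicalPhysics.QuantumFieldTheory.Balaban1983to89.B5Prop11Plancherel (Tor fine unitVec)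
open Literature.MathematicalPhysics.QuantumFieldTheory.King1986 (aK aK_pos)
open Literature.MathematicalPhysics.QuantumFieldTheory.King1986.Torus (constrainedProp fineOp flatten blockOf tdistT torCongr
  blockOf_flatten tdistT_nonneg tdistT_symm constrainedProp_deriv_decay_blocks_unif)

variable {d : ℕ} (L : ℕ) [NeZero L]

/-! ## The two-spacing η-rate of the transposed gradient, all sources, with decay from the support -/
set_option maxHeartbeats 400000 in
/-- **THE TWO-SPACING η-RATE OF THE TRANSPOSED GRADIENT OF KING'S FULL `A = 0` FLUCTUATION PROPAGATOR AS AN OPERATOR, WITH THE PRINTED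
DECAY FROM THE SUPPORT** (the (3.42)-entry-`G∇*λ` currency at `U ≡ 1` with the (3.71) second-line rate; (2.17)-summed SHAPE): for odd `L ≥ 3`,
`a > 0`, a mass cap `m₀² ≥ 0` and `0 ≤ γ < 1` there are `C, δ > 0` (functions of `d, L, a, m₀², γ`) such that for EVERY `K ≥ 1`, `n ≥ 1`, cube
`M_μ = 2L^e`, mass `0 < m² ≤ m₀²`, direction `μ`, source `f′` with `|f′| ≤ F` on the fine `(K+n)`-level lattice, every `D ∈ ℕ` and fine point `x′`
such that `f′(y′) = 0` whenever the unit blocks of `x = u x′` and `y = u y′` are at torus distance `< D`: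
`|Σ_{y′}(L^nL^K)^{−(d+1)}·[L^nL^K·(G^{η′}_{K+n}(y′ + e_μ, x′) − G^{η′}_{K+n}(y′, x′)) − L^K·(G^η_K(y + e_μ, x) − G^η_K(y, x))]·f′(y′)|
 ≤ C·(L^{−γ∕2})^K·e^{−δD}·F`.  Paired induction on `K` (module docstring).
[cite: King1986, (2.13)–(2.17) p.653, (2.20) p.654, Theorem 3.3 (3.7) p.658, Prop. 3.8 (3.71) p.664, (4.42)–(4.43) p.675; Balaban1983RegularityDecay, Theorem (1.10) p.573, (2.39) p.582] -/
theorem fullPropDTOp_rate_decay_unif (hLodd : Odd L) (hL : 2 ≤ L) {a : ℝ} (ha : 0 < a) {m0sq : ℝ} (hm0 : 0 ≤ m0sq) {γ : ℝ}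
    (hγ0 : 0 ≤ γ) (hγ1 : γ < 1) :
    ∃ C δ : ℝ, 0 < C ∧ 0 < δ ∧ ∀ (K : ℕ), 1 ≤ K → ∀ (n : ℕ), 1 ≤ n →
      ∀ (e : ℕ) (M : Fin (d + 1) → ℕ) [∀ μ, NeZero (M μ)], (∀ μ, M μ = 2 * L ^ e) →
      ∀ (msq : ℝ), 0 < msq → msq ≤ m0sq → ∀ (μ : Fin (d + 1))
      (f' : Tor (fine (L ^ n * L ^ K) M) → ℝ) (F : ℝ), (∀ y', |f' y'| ≤ F) → ∀ (D : ℕ) (x' : Tor (fine (L ^ n * L ^ K) M)),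
        (∀ y', f' y' ≠ 0 → (D : ℝ) ≤ tdistT M (blockOf (L ^ K) M (underPtN L K n M x')) (blockOf (L ^ K) M (underPtN L K n M y'))) →
        |∑ y', ((((L ^ n * L ^ K : ℕ) : ℝ) ^ (d + 1))⁻¹ *
            (((L ^ n * L ^ K : ℕ) : ℝ) *
                (constrainedProp (L ^ n * L ^ K) M (aK a L (K + n)) (((L ^ n * L ^ K : ℕ) : ℝ) ^ 2) msq
                    (y' + unitVec (fine (L ^ n * L ^ K) M) μ) x'
                  - constrainedProp (L ^ n * L ^ K) M (aK a L (K + n)) (((L ^ n * L ^ K : ℕ) : ℝ) ^ 2) msq y' x')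
              - ((L ^ K : ℕ) : ℝ) *
                (constrainedProp (L ^ K) M (aK a L K) (((L ^ K : ℕ) : ℝ) ^ 2) msq
                    (underPtN L K n M y' + unitVec (fine (L ^ K) M) μ) (underPtN L K n M x')
                  - constrainedProp (L ^ K) M (aK a L K) (((L ^ K : ℕ) : ℝ) ^ 2) msq
                    (underPtN L K n M y') (underPtN L K n M x')))
            * f' y')|
          ≤ C * (((L : ℝ) ^ (-(γ / 2))) ^ K) * Real.exp (-(δ * D)) * F := by
  have hL1 : 1 < L := by omega
  have hL1' : (1 : ℝ) < L := by exact_mod_cast hL1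
  have hL0 : (0 : ℝ) < L := by positivity
  have hLne : (L : ℝ) ≠ 0 := hL0.ne'
  have hLm1 : (1 : ℝ) ≤ (L : ℝ) - 1 := by
    have : (2 : ℝ) ≤ L := by exact_mod_cast hL
    linarith
  -- the rate `θ = L^{−γ∕2}` and the gain margin `ρ = L·θ − 1 = L^{1−γ∕2} − 1 > 0` (`γ < 1`)
  set θ : ℝ := (L : ℝ) ^ (-(γ / 2)) with hθdef
  have hθ0 : 0 < θ := Real.rpow_pos_of_pos hL0 _
  have hLθ : (L : ℝ) * θ = (L : ℝ) ^ (1 - γ / 2) := by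
    rw [hθdef, show (1 : ℝ) - γ / 2 = 1 + -(γ / 2) by ring, Real.rpow_add hL0, Real.rpow_one]
  set ρ : ℝ := (L : ℝ) * θ - 1 with hρdef
  have hρ : 0 < ρ := by
    rw [hρdef, hLθ]
    linarith [Real.one_lt_rpow hL1' (show (0 : ℝ) < 1 - γ / 2 by linarith)]
  obtain ⟨c₀, δ₀, hc₀, hδ₀, H₀⟩ := fullPropDTOp_decay_unif (d := d) L hLodd hL ha hm0
  obtain ⟨δb, cb, hδb, hcb, Hb⟩ := constrainedProp_deriv_decay_blocks_unif (d + 1) L (by omega) ⟨hLodd, hL1⟩ ha hm0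
  obtain ⟨Cr, κ, hCr, hκ, Hr⟩ := ksDSlice_rate_unif (d := d) L hLodd hL ha hm0 hγ0 hγ1
  have hKb := latticeConst_nonneg (d + 1) (half_pos hδb).le
  have hKr := latticeConst_nonneg (d + 1) (half_pos hκ).le
  -- the decay rate: below the three input rates
  set δ : ℝ := min δ₀ (min (δb / 2) (κ / 2)) with hδdef
  have hδ : 0 < δ := lt_min hδ₀ (lt_min (half_pos hδb) (half_pos hκ))
  have hδ0' : δ ≤ δ₀ := min_le_left _ _
  have hδb' : δ ≤ δb / 2 := (min_le_right _ _).trans (min_le_left _ _)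
  have hδκ : δ ≤ κ / 2 := (min_le_right _ _).trans (min_le_right _ _)
  set B₁ : ℝ := c₀ + (L : ℝ) ^ (d + 1) * cb * latticeConst (d + 1) (δb / 2) with hB₁
  have hB₁0 : 0 < B₁ := by positivity
  set R : ℝ := Cr * latticeConst (d + 1) (κ / 2) with hRdef
  have hR0 : 0 ≤ R := by positivity
  set C : ℝ := B₁ / θ + R / ρ + 1 with hCdef
  have hC : 0 < C := by positivity
  have hCθ : B₁ ≤ C * θ := by
    rw [hCdef]
    have h1 : B₁ = B₁ / θ * θ := by field_simp
    have h2 : 0 ≤ (R / ρ + 1) * θ := by positivity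
    nlinarith
  have hCρ : R ≤ C * ρ := by
    rw [hCdef]
    have h1 : R = R / ρ * ρ := by field_simp
    have h2 : 0 ≤ (B₁ / θ + 1) * ρ := by positivity
    nlinarith
  -- monotonicity of the weight in the rate
  have hEmono : ∀ {r : ℝ} {D : ℕ}, δ ≤ r → Real.exp (-(r * D)) ≤ Real.exp (-(δ * D)) := fun hr =>
    Real.exp_le_exp.mpr (neg_le_neg (mul_le_mul_of_nonneg_right hr (Nat.cast_nonneg _)))
  refine ⟨C, δ, hC, hδ, ?_⟩
  intro K hK
  induction K, hK using Nat.le_induction with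
  | base =>
    intro n hn e M _ hM msq hmsq hcap μ f' F hF D x' hsupp
    have hF0 : 0 ≤ F := (abs_nonneg _).trans (hF x')
    set w : ℝ := ((((L ^ n * L ^ 1 : ℕ) : ℝ)) ^ (d + 1))⁻¹ with hw
    have hw0 : 0 ≤ w := by positivity
    set E : ℝ := Real.exp (-(δ * D)) with hEdef
    have hE0 : 0 < E := Real.exp_pos _
    set P' : Params := ⟨d + 1, L, e, 1 + n, by omega, ⟨hLodd, hL1⟩⟩ with hP'
    have hMK' : ∀ μ, M μ = P'.sitesPerDir P'.K := fun μ => by rw [hM μ]; simp [hP', Params.sitesPerDir]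
    set P : Params := ⟨d + 1, L, e, 1, by omega, ⟨hLodd, hL1⟩⟩ with hP
    have hMK : ∀ μ, M μ = P.sitesPerDir P.K := fun μ => by rw [hM μ]; simp [hP, Params.sitesPerDir]
    -- the support condition in the fine run's blocks
    have hsupp' : ∀ y', f' y' ≠ 0 → (D : ℝ) ≤ tdistT M (blockOf (L ^ n * L ^ 1) M x') (blockOf (L ^ n * L ^ 1) M y') := by
      intro y' hy
      have h := hsupp y' hy
      rwa [blockOf_underPtN, blockOf_underPtN] at h
    -- abbreviations for the two kernels of the pair
    set G' := constrainedProp (L ^ n * L ^ 1) M (aK a L (1 + n)) (((L ^ n * L ^ 1 : ℕ) : ℝ) ^ 2) msq with hG'def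
    set G₁ := constrainedProp (L ^ 1) M (aK a L 1) (((L ^ 1 : ℕ) : ℝ) ^ 2) msq with hG₁def
    set N' : ℝ := ((L ^ n * L ^ 1 : ℕ) : ℝ) with hN'def
    -- the fine term: the single-run transposed bound (PART Q3a), level-uniform, at `1 + n` levels
    have hfine : |∑ y', w * (N' * (G' (y' + unitVec (fine (L ^ n * L ^ 1) M) μ) x' - G' y' x')) * f' y'| ≤ c₀ * E * F := by
      have h := H₀ (1 + n) (by omega) (L ^ n * L ^ 1) (by rw [pow_add, pow_one, mul_comm]) e M hM msq hmsq hcap μ f' F hF D x'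
        hsupp'
      exact h.trans (mul_le_mul_of_nonneg_right (mul_le_mul_of_nonneg_left (hEmono hδ0') hc₀.le) hF0)
    -- the coarse term read through the pairing: the one-level derivative kernel transposed (letter symmetric in the blocks)
    have hcoarse : |∑ y', w * ((((L ^ 1 : ℕ) : ℝ)) * (G₁ (underPtN L 1 n M y' + unitVec (fine (L ^ 1) M) μ) (underPtN L 1 n M x')
            - G₁ (underPtN L 1 n M y') (underPtN L 1 n M x'))) * f' y'|
          ≤ (L : ℝ) ^ (d + 1) * cb * latticeConst (d + 1) (δb / 2) * E * F := by
      have hk : ∀ y', |(((L ^ 1 : ℕ) : ℝ)) * (G₁ (underPtN L 1 n M y' + unitVec (fine (L ^ 1) M) μ) (underPtN L 1 n M x')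
            - G₁ (underPtN L 1 n M y') (underPtN L 1 n M x'))|
          ≤ (L : ℝ) ^ (d + 1) * cb * Real.exp (-(δb * tdistT M (blockOf (L ^ n * L ^ 1) M x') (blockOf (L ^ n * L ^ 1) M y'))) := by
        intro y'
        have h1 := Hb P rfl rfl le_rfl msq hmsq.le hcap M hMK (L ^ 1) rfl (underPtN L 1 n M y') (underPtN L 1 n M x') μ
        have hcast : (((L ^ 1 : ℕ) : ℝ)) ^ P.d * cb = (L : ℝ) ^ (d + 1) * cb := by simp [hP]
        rw [hcast, blockOf_underPtN, blockOf_underPtN, tdistT_symm] at h1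
        exact h1
      have h := pairOp_decay_le (L ^ n * L ^ 1) M hδb (by positivity)
        (fun x'' y' => (((L ^ 1 : ℕ) : ℝ)) * (G₁ (underPtN L 1 n M y' + unitVec (fine (L ^ 1) M) μ) (underPtN L 1 n M x'')
            - G₁ (underPtN L 1 n M y') (underPtN L 1 n M x''))) x' hk f' hF hsupp'
      refine (le_of_eq ?_).trans (h.trans ?_)
      · rfl
      · exact mul_le_mul_of_nonneg_right (mul_le_mul_of_nonneg_left (hEmono hδb') (by positivity)) hF0
    -- split the pair termwise and add up
    have hsum_eq : ∑ y', w * (N' * (G' (y' + unitVec (fine (L ^ n * L ^ 1) M) μ) x' - G' y' x')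
          - (((L ^ 1 : ℕ) : ℝ)) * (G₁ (underPtN L 1 n M y' + unitVec (fine (L ^ 1) M) μ) (underPtN L 1 n M x')
            - G₁ (underPtN L 1 n M y') (underPtN L 1 n M x'))) * f' y'
        = ∑ y', w * (N' * (G' (y' + unitVec (fine (L ^ n * L ^ 1) M) μ) x' - G' y' x')) * f' y'
          - ∑ y', w * ((((L ^ 1 : ℕ) : ℝ)) * (G₁ (underPtN L 1 n M y' + unitVec (fine (L ^ 1) M) μ) (underPtN L 1 n M x')
            - G₁ (underPtN L 1 n M y') (underPtN L 1 n M x'))) * f' y' := by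
      rw [← Finset.sum_sub_distrib]
      exact Finset.sum_congr rfl fun y' _ => by ring
    have hθ1 : B₁ * (E * F) ≤ C * θ ^ 1 * E * F := by
      rw [pow_one, mul_assoc (C * θ)]
      exact mul_le_mul_of_nonneg_right hCθ (by positivity)
    calc |∑ y', w * (N' * (G' (y' + unitVec (fine (L ^ n * L ^ 1) M) μ) x' - G' y' x')
            - (((L ^ 1 : ℕ) : ℝ)) * (G₁ (underPtN L 1 n M y' + unitVec (fine (L ^ 1) M) μ) (underPtN L 1 n M x')
              - G₁ (underPtN L 1 n M y') (underPtN L 1 n M x'))) * f' y'|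
        = |∑ y', w * (N' * (G' (y' + unitVec (fine (L ^ n * L ^ 1) M) μ) x' - G' y' x')) * f' y'
            - ∑ y', w * ((((L ^ 1 : ℕ) : ℝ)) * (G₁ (underPtN L 1 n M y' + unitVec (fine (L ^ 1) M) μ) (underPtN L 1 n M x')
              - G₁ (underPtN L 1 n M y') (underPtN L 1 n M x'))) * f' y'| := by rw [hsum_eq]
      _ ≤ |∑ y', w * (N' * (G' (y' + unitVec (fine (L ^ n * L ^ 1) M) μ) x' - G' y' x')) * f' y'|
            + |∑ y', w * ((((L ^ 1 : ℕ) : ℝ)) * (G₁ (underPtN L 1 n M y' + unitVec (fine (L ^ 1) M) μ) (underPtN L 1 n M x')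
              - G₁ (underPtN L 1 n M y') (underPtN L 1 n M x'))) * f' y'| := abs_sub _ _
      _ ≤ c₀ * E * F + (L : ℝ) ^ (d + 1) * cb * latticeConst (d + 1) (δb / 2) * E * F := add_le_add hfine hcoarse
      _ = B₁ * (E * F) := by rw [hB₁]; ring
      _ ≤ C * θ ^ 1 * E * F := hθ1
  | succ K hK IH =>
    intro n hn e M _ hM msq hmsq hcap μ f'' F hF D x'' hsupp0
    have hF0 : 0 ≤ F := (abs_nonneg _).trans (hF x'')
    obtain rfl : M = fun _ => 2 * L ^ e := funext hM
    set i : KSliceIdx d := ⟨e, K, hK, n, hn, 0, Nat.zero_le e, 1, le_rfl⟩ with hidef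
    have h : ∀ ν, fine (L ^ n * L ^ K * L) (ksM L i) ν = fine (L ^ n * L ^ (K + 1)) (ksM L i) ν :=
      fine_assoc L K n (ksM L i)
    obtain ⟨x', rfl⟩ := ((flatten (L ^ n * L ^ K) L (ksM L i)).trans (torCongr h)).surjective x''
    simp only [Equiv.trans_apply] at hsupp0 ⊢
    rw [underPtN_flatten L K n (ksM L i) h x'] at hsupp0 ⊢
    set E : ℝ := Real.exp (-(δ * D)) with hEdef
    have hE0 : 0 < E := Real.exp_pos _
    have hgF : ∀ y' : Tor (fine (L ^ n * L ^ K) (ksU L i)),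
        |(fun y' => f'' (torCongr h (flatten (L ^ n * L ^ K) L (ksM L i) y'))) y'| ≤ F := fun y' => hF _
    have hL2 : (0 : ℝ) < (L : ℝ) ^ 2 := by positivity
    have hm2 : 0 < msq / (L : ℝ) ^ 2 := div_pos hmsq hL2
    have hm2cap : msq / (L : ℝ) ^ 2 ≤ m0sq := by
      have h1 : (1 : ℝ) ≤ (L : ℝ) ^ 2 := one_le_pow₀ hL1'.le
      exact (div_le_self hmsq.le h1).trans hcap
    have hM' : ∀ μ, ksU L i μ = 2 * L ^ (e + 1) := fun μ => by
      show L * (2 * L ^ e) = 2 * L ^ (e + 1)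
      ring
    -- the support condition one level down: block distances only grow under the peel
    have hsupp : ∀ y' : Tor (fine (L ^ n * L ^ K) (ksU L i)),
        (fun y' => f'' (torCongr h (flatten (L ^ n * L ^ K) L (ksM L i) y'))) y' ≠ 0 →
          (D : ℝ) ≤ tdistT (ksU L i) (blockOf (L ^ K) (ksU L i) (underPtN L K n (ksU L i) x'))
            (blockOf (L ^ K) (ksU L i) (underPtN L K n (ksU L i) y')) := by
      intro y' hy
      have h0 := hsupp0 (torCongr h (flatten (L ^ n * L ^ K) L (ksM L i) y')) hy
      rw [underPtN_flatten L K n (ksM L i) h y'] at h0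
      set ux := underPtN L K n (ksU L i) x' with hux
      set uy := underPtN L K n (ksU L i) y' with huy
      have hBx : blockOf (L ^ (K + 1)) (fun _ : Fin (d + 1) => 2 * L ^ e) (flatten (L ^ K) L (ksM L i) ux)
          = blockOf L (ksM L i) (blockOf (L ^ K) (ksU L i) ux) := blockOf_flatten (L ^ K) L (ksM L i) ux
      have hBy : blockOf (L ^ (K + 1)) (fun _ : Fin (d + 1) => 2 * L ^ e) (flatten (L ^ K) L (ksM L i) uy)
          = blockOf L (ksM L i) (blockOf (L ^ K) (ksU L i) uy) := blockOf_flatten (L ^ K) L (ksM L i) uy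
      rw [hBx, hBy] at h0
      have hgrow := mul_tdistT_blockOf_le L (ksM L i) (blockOf (L ^ K) (ksU L i) ux) (blockOf (L ^ K) (ksU L i) uy)
      have hsub0 := tdistT_nonneg (ksU L i) (blockOf (L ^ K) (ksU L i) ux) (blockOf (L ^ K) (ksU L i) uy)
      rcases Nat.eq_zero_or_pos D with hD0 | hDpos
      · rw [hD0, Nat.cast_zero]; exact hsub0
      · have hD1 : (1 : ℝ) ≤ D := by exact_mod_cast hDpos
        have hprod : 0 ≤ ((L : ℝ) - 1) * ((D : ℝ) - 1) := mul_nonneg (by linarith) (by linarith)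
        nlinarith
    have hpeel := fullPropDTOp_peel_pair L hL ha hmsq i μ h f'' x'
    set w : ℝ := ((((L ^ n * L ^ K : ℕ) : ℝ)) ^ (d + 1))⁻¹ with hw
    -- abbreviations one level down
    set G's := constrainedProp (L ^ n * L ^ K) (ksU L i) (aK a L (K + n)) (((L ^ n * L ^ K : ℕ) : ℝ) ^ 2) (msq / (L : ℝ) ^ 2)
      with hG's
    set Gs := constrainedProp (L ^ K) (ksU L i) (aK a L K) (((L ^ K : ℕ) : ℝ) ^ 2) (msq / (L : ℝ) ^ 2) with hGs
    have hIH : |∑ y', w * ((((L ^ n * L ^ K : ℕ) : ℝ)) * (G's (y' + unitVec (fine (L ^ n * L ^ K) (ksU L i)) μ) x' - G's y' x')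
            - (((L ^ K : ℕ) : ℝ)) * (Gs (underPtN L K n (ksU L i) y' + unitVec (fine (L ^ K) (ksU L i)) μ) (underPtN L K n (ksU L i) x')
              - Gs (underPtN L K n (ksU L i) y') (underPtN L K n (ksU L i) x')))
            * f'' (torCongr h (flatten (L ^ n * L ^ K) L (ksM L i) y'))| ≤ C * θ ^ K * E * F :=
      IH n hn (e + 1) (ksU L i) hM' (msq / (L : ℝ) ^ 2) hm2 hm2cap μ _ F hgF D x' hsupp
    -- the gradient-slice pair: §1 with the letter of part M′
    have hS0 : |∑ y', w * (ksDSlice' L a (msq / (L : ℝ) ^ 2) i μ y' x'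
            - ksDSlice L a (msq / (L : ℝ) ^ 2) i μ (underPtN L K n (ksU L i) y') (underPtN L K n (ksU L i) x'))
            * f'' (torCongr h (flatten (L ^ n * L ^ K) L (ksM L i) y'))|
          ≤ Cr * θ ^ K * latticeConst (d + 1) (κ / 2) * Real.exp (-(κ / 2 * D)) * F := by
      have hk : ∀ y', |ksDSlice' L a (msq / (L : ℝ) ^ 2) i μ y' x'
            - ksDSlice L a (msq / (L : ℝ) ^ 2) i μ (underPtN L K n (ksU L i) y') (underPtN L K n (ksU L i) x')|
          ≤ Cr * θ ^ K * Real.exp (-(κ * tdistT (ksU L i) (blockOf (L ^ n * L ^ K) (ksU L i) x')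
              (blockOf (L ^ n * L ^ K) (ksU L i) y'))) := by
        intro y'
        have h1 := Hr (msq / (L : ℝ) ^ 2) hm2 hm2cap i μ y' x'
        rw [blockOf_underPtN, blockOf_underPtN, tdistT_symm] at h1
        exact h1
      have hsupp'' : ∀ y', (fun y' => f'' (torCongr h (flatten (L ^ n * L ^ K) L (ksM L i) y'))) y' ≠ 0 →
          (D : ℝ) ≤ tdistT (ksU L i) (blockOf (L ^ n * L ^ K) (ksU L i) x') (blockOf (L ^ n * L ^ K) (ksU L i) y') := by
        intro y' hy
        have h0 := hsupp y' hy
        rwa [blockOf_underPtN, blockOf_underPtN] at h0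
      exact pairOp_decay_le (L ^ n * L ^ K) (ksU L i) hκ (by positivity)
        (fun x'' y' => ksDSlice' L a (msq / (L : ℝ) ^ 2) i μ y' x''
          - ksDSlice L a (msq / (L : ℝ) ^ 2) i μ (underPtN L K n (ksU L i) y') (underPtN L K n (ksU L i) x'')) x' hk
        (fun y' => f'' (torCongr h (flatten (L ^ n * L ^ K) L (ksM L i) y'))) hgF hsupp''
    have hS : |∑ y', w * (ksDSlice' L a (msq / (L : ℝ) ^ 2) i μ y' x'
            - ksDSlice L a (msq / (L : ℝ) ^ 2) i μ (underPtN L K n (ksU L i) y') (underPtN L K n (ksU L i) x'))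
            * f'' (torCongr h (flatten (L ^ n * L ^ K) L (ksM L i) y'))|
          ≤ R * θ ^ K * E * F := by
      refine hS0.trans ?_
      rw [hRdef]
      have h1 : Cr * θ ^ K * latticeConst (d + 1) (κ / 2) * Real.exp (-(κ / 2 * D)) * F
          = Cr * latticeConst (d + 1) (κ / 2) * θ ^ K * Real.exp (-(κ / 2 * D)) * F := by ring
      rw [h1]
      exact mul_le_mul_of_nonneg_right (mul_le_mul_of_nonneg_left (hEmono hδκ) (by positivity)) hF0
    have hsum : ∑ y', w * (((((L ^ n * L ^ K : ℕ) : ℝ)) * (G's (y' + unitVec (fine (L ^ n * L ^ K) (ksU L i)) μ) x' - G's y' x')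
              - (((L ^ K : ℕ) : ℝ)) * (Gs (underPtN L K n (ksU L i) y' + unitVec (fine (L ^ K) (ksU L i)) μ) (underPtN L K n (ksU L i) x')
                - Gs (underPtN L K n (ksU L i) y') (underPtN L K n (ksU L i) x')))
            + (ksDSlice' L a (msq / (L : ℝ) ^ 2) i μ y' x'
              - ksDSlice L a (msq / (L : ℝ) ^ 2) i μ (underPtN L K n (ksU L i) y') (underPtN L K n (ksU L i) x')))
            * f'' (torCongr h (flatten (L ^ n * L ^ K) L (ksM L i) y'))
        = ∑ y', w * ((((L ^ n * L ^ K : ℕ) : ℝ)) * (G's (y' + unitVec (fine (L ^ n * L ^ K) (ksU L i)) μ) x' - G's y' x')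
              - (((L ^ K : ℕ) : ℝ)) * (Gs (underPtN L K n (ksU L i) y' + unitVec (fine (L ^ K) (ksU L i)) μ) (underPtN L K n (ksU L i) x')
                - Gs (underPtN L K n (ksU L i) y') (underPtN L K n (ksU L i) x')))
              * f'' (torCongr h (flatten (L ^ n * L ^ K) L (ksM L i) y'))
          + ∑ y', w * (ksDSlice' L a (msq / (L : ℝ) ^ 2) i μ y' x'
              - ksDSlice L a (msq / (L : ℝ) ^ 2) i μ (underPtN L K n (ksU L i) y') (underPtN L K n (ksU L i) x'))
              * f'' (torCongr h (flatten (L ^ n * L ^ K) L (ksM L i) y')) := by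
      rw [← Finset.sum_add_distrib]
      exact Finset.sum_congr rfl fun y' _ => by ring
    -- the gain: `L^{−1}·(C + R)·θ^K ≤ C·θ^{K+1}` because `R ≤ C·ρ = C·(Lθ − 1)`
    have hgain : ((L : ℝ))⁻¹ * (C * θ ^ K * E * F + R * θ ^ K * E * F) ≤ C * θ ^ (K + 1) * E * F := by
      have hq : 0 ≤ θ ^ K * E * F := by positivity
      have h1 : C * θ ^ K * E * F + R * θ ^ K * E * F = (C + R) * (θ ^ K * E * F) := by ring
      have h2 : C * θ ^ (K + 1) * E * F = (C * θ) * (θ ^ K * E * F) := by rw [pow_succ]; ring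
      rw [h1, h2, ← mul_assoc]
      refine mul_le_mul_of_nonneg_right ?_ hq
      rw [inv_mul_le_iff₀ hL0]
      have h3 : (L : ℝ) * (C * θ) = C * ρ + C := by rw [hρdef]; ring
      rw [h3]
      linarith
    have hLi : (0 : ℝ) ≤ ((L : ℝ))⁻¹ := by positivity
    calc |∑ y'' : Tor (fine (L ^ n * L ^ (K + 1)) (ksM L i)),
            ((((L ^ n * L ^ (K + 1) : ℕ) : ℝ) ^ (d + 1))⁻¹ *
              (((L ^ n * L ^ (K + 1) : ℕ) : ℝ) *
                  (constrainedProp (L ^ n * L ^ (K + 1)) (ksM L i) (aK a L (K + 1 + n))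
                      (((L ^ n * L ^ (K + 1) : ℕ) : ℝ) ^ 2) msq
                      (y'' + unitVec (fine (L ^ n * L ^ (K + 1)) (ksM L i)) μ) (torCongr h (flatten (L ^ n * L ^ K) L (ksM L i) x'))
                    - constrainedProp (L ^ n * L ^ (K + 1)) (ksM L i) (aK a L (K + 1 + n))
                      (((L ^ n * L ^ (K + 1) : ℕ) : ℝ) ^ 2) msq
                      y'' (torCongr h (flatten (L ^ n * L ^ K) L (ksM L i) x')))
                - ((L ^ (K + 1) : ℕ) : ℝ) *
                  (constrainedProp (L ^ (K + 1)) (ksM L i) (aK a L (K + 1)) (((L ^ (K + 1) : ℕ) : ℝ) ^ 2) msq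
                      (underPtN L (K + 1) n (ksM L i) y'' + unitVec (fine (L ^ (K + 1)) (ksM L i)) μ)
                      (flatten (L ^ K) L (ksM L i) (underPtN L K n (ksU L i) x'))
                    - constrainedProp (L ^ (K + 1)) (ksM L i) (aK a L (K + 1)) (((L ^ (K + 1) : ℕ) : ℝ) ^ 2) msq
                      (underPtN L (K + 1) n (ksM L i) y'')
                      (flatten (L ^ K) L (ksM L i) (underPtN L K n (ksU L i) x'))))
              * f'' y'')|
        = ((L : ℝ))⁻¹ *
          |∑ y', w * ((((L ^ n * L ^ K : ℕ) : ℝ)) * (G's (y' + unitVec (fine (L ^ n * L ^ K) (ksU L i)) μ) x' - G's y' x')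
              - (((L ^ K : ℕ) : ℝ)) * (Gs (underPtN L K n (ksU L i) y' + unitVec (fine (L ^ K) (ksU L i)) μ) (underPtN L K n (ksU L i) x')
                - Gs (underPtN L K n (ksU L i) y') (underPtN L K n (ksU L i) x')))
              * f'' (torCongr h (flatten (L ^ n * L ^ K) L (ksM L i) y'))
          + ∑ y', w * (ksDSlice' L a (msq / (L : ℝ) ^ 2) i μ y' x'
              - ksDSlice L a (msq / (L : ℝ) ^ 2) i μ (underPtN L K n (ksU L i) y') (underPtN L K n (ksU L i) x'))
              * f'' (torCongr h (flatten (L ^ n * L ^ K) L (ksM L i) y'))| := by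
          rw [hpeel, hsum, abs_mul, abs_of_nonneg hLi]
      _ ≤ ((L : ℝ))⁻¹ * (C * θ ^ K * E * F + R * θ ^ K * E * F) :=
          mul_le_mul_of_nonneg_left ((abs_add_le _ _).trans (add_le_add hIH hS)) hLi
      _ ≤ C * θ ^ (K + 1) * E * F := hgain

end Summit.QuantumFields.YangMills.BalabanUVNodes.N15KingModelRung.Curved
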